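import Summits.ResolutionOfSingularities.ResolutionOfSingularities.Theorems.HilbertSamuelEliminationSigmaMaxModificationsCorridor3MovingCompactnessComposition
import Summits.ResolutionOfSingularities.ResolutionOfSingularities.Theorems.HilbertSamuelEliminationSigmaMaxModificationsCorridor3MovingCompactnessEventuallyConst
import HarnessLib

/-!
# Route `HilbertSamuelElimination`, crux `SigmaMaxModificationsCorridor3` (stmt-ResolutionOfSingularities-19249), registered
# skeleton `w_ladder` v5 MOVING (e55bf4f23146f08b): the registered stub `stub_movingCompactness` (L∞) BY NAME AND SIGNATURE

[OURS · L1 W4.2] (cell res-hironaka, LADDER-RESOLUTION rung L, D-0089). NOT statements of H. Hironaka's manuscript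
[Hironaka2017]; nothing of the manuscript is used or asserted. AI-written, weaker than expert review.

`stub_movingCompactness : MovingCompactness.{0}` (the tree's `SigmaMaxModificationsCorridor3.Moving.MovingCompactness`,
res-type-053 p496136) from idea-2's line `moving-compactness` (89d540dcceefd65f): composition `movingCompactness_of_stub3`
(res-type-005 p498231; helper stubs 1+2 p496952 inside) applied to helper stub 3 `stub_movingChain_of_leastLabel_eventuallyConst`
(res-type-064, parts p498069 `…MovingCompactnessRunLabelling` / `…MovingCompactnessPersistence` / `…MovingCompactnessEventuallyConst`; cycle-end piece res-type-005 p498054). Template by res-type-005 (`L/res-type-005/StubMovingCompactness.template.lean` 20a586858b7edf40), filed by res-type-064. File with `ledger propose --kind proof --target …/Theorems/HilbertSamuelEliminationSigmaMaxModificationsCorridor3WLadderMovingCompactness.lean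
--supports stmt-ResolutionOfSingularities-19249` (NO `--as helper`: it proves a registered stub by name + signature).

## Sources

* V. Cossart, U. Jannsen, S. Saito, LNM 2270 (2020), Rem. 6.29 (1), p. 95, p. 105, p. 107. [CossartJannsenSaito2020]
-/

set_option linter.dupNamespace false -- mandated namespace of this single-conjunct summit

noncomputable section

open CategoryTheory AlgebraicGeometry TopologicalSpace Topology
open Literature.AlgebraicGeometry.Resolution Literature.RingTheory.HilbertSamuel
open Summit.ResolutionOfSingularities.ResolutionOfSingularities.Theorems.SigmaMaxModificationsCorridor3
open Summit.ResolutionOfSingularities.ResolutionOfSingularities.Theorems.SigmaMaxModificationsCorridor3.Moving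
open Summit.ResolutionOfSingularities.ResolutionOfSingularities.Theorems.CampaignW42
open Summit.ResolutionOfSingularities.ResolutionOfSingularities.Cruxes.SigmaMaxModifications.MovingCompactnessLine

namespace Summit.ResolutionOfSingularities.ResolutionOfSingularities.Cruxes.SigmaMaxModificationsCorridor3.WLadder

/-- **STUB L∞ (M): MOVING COMPACTNESS** — an infinite canonical sequence `S(X, ν)` from a good initial state carries an infinite chain
of closed near points whose marked point is blown up infinitely often (idea-2's least-label dichotomy: helper stubs 1+2 p496952,
cycle-end p498054, composition p498231 (res-type-005); helper stub 3 (res-type-064)). [cite: CossartJannsenSaito2020, Rem. 6.29 (1), p. 95, p. 107] -/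
theorem stub_movingCompactness : MovingCompactness.{0} :=
  movingCompactness_of_stub3 (fun hRf _ _ hgood _ hx hxcl _ h0 hstep hconst =>
    stub_movingChain_of_leastLabel_eventuallyConst hRf hgood hx hxcl h0 hstep hconst)

end Summit.ResolutionOfSingularities.ResolutionOfSingularities.Cruxes.SigmaMaxModificationsCorridor3.WLadder

end
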